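import Summits.CriticalPhenomena.CardyFormulaZ2.Theorems.CardyBoundaryCoulombGasRectilinearCardyDefs
import Literature.Probability.LatticeModels.FlatBoundaryPoissonKernelLimit

/-!
# Closure-discretised random-walk objects of the line `excursion-kernel-covariance`
# (crux `RectilinearCardy`, stmt-CriticalPhenomena-5660, route `CardyBoundaryCoulombGas`)

Second DEFINITIONS MODULE of the line (continuation lead `prover-line-stmt-CriticalPhenomena-5660-c1-0`,
2026-08-16, reshape c1-1 of the skeleton `Cruxes/RectilinearCardy/Lines/excursion_kernel_covariance.lean`).
The first module `CardyBoundaryCoulombGasRectilinearCardyDefs` (p95886) built the cube-root kernel on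
Smirnov's OPEN discretisation `meshDomain`; the reshaped skeleton re-bases the random-walk side of the
line on the CLOSURE discretisation `V_δ = {v ∈ ℤ² : δ v ∈ Ω̄}` with its one-outer-neighbour boundary
row — verbatim the conventions of the tree's PROVED flat-boundary potential theory
`Literature.Probability.LatticeModels.ChelkakSmirnov2011_boundaryNormalisedPoissonKernelLimit_holds` and
`Kenyon2000_flatEdgePoissonKernelLimit_holds` (rectilinear Jordan domains; vertex sets
`{v | meshPoint δ v ∈ closure D.carrier}`, boundary-row points = "exactly one lattice neighbour outside",
Green function `dirichletGreen` of that `Finset`) — so that the kernel stubs of the line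
(`stub_kernelPointAsymptotics`, `stub_kernelWindowLaw`) and the lever `stub_cubeRootLaw` can be stated
over named constants and discharged directly from those facts. Nothing is asserted here beyond
bookkeeping lemmas (membership, non-negativity, monotonicity of the tail mass).

Objects: `closureFinset R δ` (`V_δ`), `boundaryRow R δ` (its boundary row), `markRow R δ i` (pole
representative of the mark `pt i` on the row), `rowWeight R δ v = (G_δ(v,a_δ) G_δ(v,b_δ) G_δ(v,d_δ))^{1/3}`
(the cube-root weight, `G_δ = dirichletGreen V_δ`), `rowTail R δ s` (row vertices attributed to the tail arc
`∂Ω[s, d]` by Smirnov's closest-arc rule, as `discreteArc`), `rowMass R δ s` (its `W`-mass), the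
continuum tail `contTail R g s = F(η(g a, g b, g s, g d))`, and the predicate `FlatMarks R`.
Sources: Chelkak–Smirnov, Adv. Math. 228 (2011) Thm 3.13; Kenyon, Ann. Probab. 28 (2000) Cor. 19;
Smirnov 2001 §2 (closest-arc rule); the line card `Cruxes/RectilinearCardy/Lines/excursion-kernel-covariance.md`.
-/

noncomputable section

open Set Filter Topology
open Literature.Probability.RandomPlanarGeometry
open Literature.Probability.LatticeModels (Site meshPoint meshVertices meshVertices_finite dirichletGreen
  zdGraph)

namespace Summit.CriticalPhenomena.CardyFormulaZ2.Cruxes.RectilinearCardy.ExcursionKernelCovariance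

/-! ### The objects -/

/-- The CLOSURE DISCRETISATION `V_δ = {v ∈ ℤ² : δ v ∈ Ω̄}` of the carrier as a `Finset` (empty junk for
`δ ≤ 0`) — the vertex set of the tree's proved flat-boundary potential theory
(`Kenyon2000_flatEdgePoissonKernelLimit`, `ChelkakSmirnov2011_boundaryNormalisedPoissonKernelLimit`).
[cite: ChelkakSmirnov2011, Thm. 3.13] -/
def closureFinset (R : ConformalRectangle) (δ : ℝ) : Finset (Site 2) :=
  if h : 0 < δ then (meshVertices_finite (Ω := closure R.carrier) R.isBounded.closure h).toFinset
  else ∅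

/-- The BOUNDARY ROW of `V_δ`: vertices with exactly one lattice neighbour outside `V_δ` (the
`a_n`/`b_n` of the tree's CS11/Kenyon facts, verbatim). [cite: ChelkakSmirnov2011, Thm. 3.13] -/
def boundaryRow (R : ConformalRectangle) (δ : ℝ) : Finset (Site 2) :=
  (closureFinset R δ).filter fun v =>
    (((zdGraph 2).neighborFinset v).filter fun u => u ∉ closureFinset R δ).card = 1

/-- Boundary-row representative (pole) of the mark `pt i`: a boundary-row vertex whose mesh point is
nearest to `pt i` (Hilbert `ε`; any nearest one works — its local lattice factor is common to all
weights and cancels under renormalisation; junk when the row is empty). [folklore] -/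
def markRow (R : ConformalRectangle) (δ : ℝ) (i : Fin 4) : Site 2 :=
  Classical.epsilon fun x : Site 2 => x ∈ boundaryRow R δ ∧
    ∀ y ∈ boundaryRow R δ, dist (meshPoint δ x) (R.pt i) ≤ dist (meshPoint δ y) (R.pt i)

/-- THE CUBE-ROOT WEIGHT on `V_δ`: `W(v) = (G_δ(v,a_δ) G_δ(v,b_δ) G_δ(v,d_δ))^{1/3}`,
`G_δ = dirichletGreen V_δ`, poles the boundary-row representatives of `a = pt 0`, `b = pt 1`, `d = pt 3`
(the `(1,1,1;3)` member of the route's boundary Coulomb gas read against the lattice polygon's own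
excursion kernel; sink = the moving vertex). [folklore] -/
def rowWeight (R : ConformalRectangle) (δ : ℝ) (v : Site 2) : ℝ :=
  (dirichletGreen (closureFinset R δ) v (markRow R δ 0) *
      dirichletGreen (closureFinset R δ) v (markRow R δ 1) *
      dirichletGreen (closureFinset R δ) v (markRow R δ 3)) ^ (1 / 3 : ℝ)

/-- Boundary-row vertices attributed to the tail arc `∂Ω[s, d] = tailArc R s` by Smirnov's closest-arc
rule (the `boundaryRow` analogue of `discreteArc`). [cite: Smirnov2001, §2] -/
def rowTail (R : ConformalRectangle) (δ s : ℝ) : Finset (Site 2) :=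
  (boundaryRow R δ).filter fun v =>
    Metric.infDist (meshPoint δ v) (tailArc R s) ≤
      Metric.infDist (meshPoint δ v) (frontier R.carrier \ tailArc R s)

/-- `W`-mass of the tail `∂Ω[s, d]` on the boundary row of `V_δ`. [folklore] -/
def rowMass (R : ConformalRectangle) (δ s : ℝ) : ℝ :=
  ∑ v ∈ rowTail R δ s, rowWeight R δ v

/-- The CONTINUUM TAIL in a real boundary correspondence `g`: `C(s) = F(η(g a, g b, g s, g d))`, Cardy's
function of the cross-ratio of the conformal rectangle `(Ω; a, b, ∂Ω(s), d)` read through `g`. [folklore] -/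
def contTail (R : ConformalRectangle) (g : ℝ → ℝ) (s : ℝ) : ℝ :=
  cardyFunction (crossRatio ![g (R.mark 0), g (R.mark 1), g s, g (R.mark 3)])

/-- All four marks of `R` are flat boundary points (`FlatNear`, the first module's predicate). [folklore] -/
def FlatMarks (R : ConformalRectangle) : Prop :=
  ∀ i : Fin 4, ∃ r : ℝ, 0 < r ∧ FlatNear R (R.pt i) r

/-! ### Proved bookkeeping -/

/-- Membership in `V_δ` for a positive mesh: `δ v ∈ Ω̄`. [folklore] -/
theorem mem_closureFinset_iff (R : ConformalRectangle) {δ : ℝ} (hδ : 0 < δ) {v : Site 2} :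
    v ∈ closureFinset R δ ↔ meshPoint δ v ∈ closure R.carrier := by
  unfold closureFinset
  rw [dif_pos hδ, Finite.mem_toFinset]
  rfl

/-- `V_δ` is the empty junk `Finset` for `δ ≤ 0`. [folklore] -/
theorem closureFinset_of_nonpos (R : ConformalRectangle) {δ : ℝ} (hδ : δ ≤ 0) :
    closureFinset R δ = ∅ := by
  unfold closureFinset
  rw [dif_neg (not_lt.2 hδ)]

/-- Membership in the boundary row, unfolded. [folklore] -/
theorem mem_boundaryRow_iff (R : ConformalRectangle) {δ : ℝ} {v : Site 2} :
    v ∈ boundaryRow R δ ↔ v ∈ closureFinset R δ ∧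
      (((zdGraph 2).neighborFinset v).filter fun u => u ∉ closureFinset R δ).card = 1 := by
  unfold boundaryRow
  rw [Finset.mem_filter]

/-- The boundary row lies in `V_δ`. [folklore] -/
theorem boundaryRow_subset (R : ConformalRectangle) (δ : ℝ) : boundaryRow R δ ⊆ closureFinset R δ :=
  Finset.filter_subset _ _

/-- Membership in `rowTail`, unfolded. [folklore] -/
theorem mem_rowTail_iff (R : ConformalRectangle) {δ s : ℝ} {v : Site 2} :
    v ∈ rowTail R δ s ↔ v ∈ boundaryRow R δ ∧
      Metric.infDist (meshPoint δ v) (tailArc R s) ≤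
        Metric.infDist (meshPoint δ v) (frontier R.carrier \ tailArc R s) := by
  unfold rowTail
  rw [Finset.mem_filter]

/-- `rowTail` lies in the boundary row. [folklore] -/
theorem rowTail_subset (R : ConformalRectangle) (δ s : ℝ) : rowTail R δ s ⊆ boundaryRow R δ :=
  Finset.filter_subset _ _

/-- The cube-root weight on `V_δ` is non-negative (killed Green functions are). [folklore] -/
theorem rowWeight_nonneg (R : ConformalRectangle) (δ : ℝ) (v : Site 2) : 0 ≤ rowWeight R δ v := by
  unfold rowWeight
  exact Real.rpow_nonneg (mul_nonneg (mul_nonneg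
    (Literature.Probability.LatticeModels.dirichletGreen_nonneg (by norm_num) _ _ _)
    (Literature.Probability.LatticeModels.dirichletGreen_nonneg (by norm_num) _ _ _))
    (Literature.Probability.LatticeModels.dirichletGreen_nonneg (by norm_num) _ _ _)) _

/-- `rowMass` is non-negative. [folklore] -/
theorem rowMass_nonneg (R : ConformalRectangle) (δ s : ℝ) : 0 ≤ rowMass R δ s :=
  Finset.sum_nonneg fun v _ => rowWeight_nonneg R δ v

/-- `rowTail` is monotone in the tail on `[mark 1, mark 3]`: a longer tail arc attracts more boundary-row
vertices (the closest-arc rule is monotone, as for `discreteArc_mono`). [folklore] -/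
theorem rowTail_mono (R : ConformalRectangle) (δ : ℝ) {s s' : ℝ} (h1 : R.mark 1 ≤ s)
    (hss' : s ≤ s') (h3 : s' ≤ R.mark 3) : rowTail R δ s' ⊆ rowTail R δ s := by
  intro v hv
  rw [mem_rowTail_iff] at hv ⊢
  refine ⟨hv.1, ?_⟩
  have hAA' : tailArc R s' ⊆ tailArc R s := image_mono (Icc_subset_Icc_left hss')
  have hA : (tailArc R s').Nonempty := ⟨R.boundary s', mem_image_of_mem _ (left_mem_Icc.2 h3)⟩
  have hc : (frontier R.carrier \ tailArc R s).Nonempty :=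
    ⟨R.pt 0, R.pt_mem_frontier 0, pt_zero_not_mem_tailArc R h1⟩
  calc Metric.infDist (meshPoint δ v) (tailArc R s)
      ≤ Metric.infDist (meshPoint δ v) (tailArc R s') := Metric.infDist_le_infDist_of_subset hAA' hA
    _ ≤ Metric.infDist (meshPoint δ v) (frontier R.carrier \ tailArc R s') := hv.2
    _ ≤ Metric.infDist (meshPoint δ v) (frontier R.carrier \ tailArc R s) :=
        Metric.infDist_le_infDist_of_subset (fun z hz => ⟨hz.1, fun h => hz.2 (hAA' h)⟩) hc

/-- **`rowMass` is non-increasing in `s`** on `[mark 1, mark 3]`. [folklore] -/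
theorem rowMass_antitone (R : ConformalRectangle) (δ : ℝ) {s s' : ℝ} (h1 : R.mark 1 ≤ s)
    (hss' : s ≤ s') (h3 : s' ≤ R.mark 3) : rowMass R δ s' ≤ rowMass R δ s :=
  Finset.sum_le_sum_of_subset_of_nonneg (rowTail_mono R δ h1 hss' h3)
    fun v _ _ => rowWeight_nonneg R δ v

/-- The window mass `rowMass R δ s - rowMass R δ s'` is the `W`-mass of the row vertices attributed to
`∂Ω[s, d]` but not to `∂Ω[s', d]`. [folklore] -/
theorem rowMass_sub_eq_sum_sdiff (R : ConformalRectangle) (δ : ℝ) {s s' : ℝ} (h1 : R.mark 1 ≤ s)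
    (hss' : s ≤ s') (h3 : s' ≤ R.mark 3) :
    rowMass R δ s - rowMass R δ s' = ∑ v ∈ rowTail R δ s \ rowTail R δ s', rowWeight R δ v := by
  unfold rowMass
  rw [← Finset.sum_sdiff (rowTail_mono R δ h1 hss' h3), add_sub_cancel_right]

/-- `contTail` at `mark 2` is Cardy's function of the cross-ratio of the datum `i ↦ g (mark i)`. [folklore] -/
theorem contTail_mark_two (R : ConformalRectangle) (g : ℝ → ℝ) :
    contTail R g (R.mark 2) = cardyFunction (crossRatio fun i => g (R.mark i)) := by
  unfold contTail
  congr 2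
  funext i
  fin_cases i <;> rfl

end Summit.CriticalPhenomena.CardyFormulaZ2.Cruxes.RectilinearCardy.ExcursionKernelCovariance

end
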